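import Literature.MathematicalPhysics.QuantumFieldTheory.Balaban1983to89.Beta.BubbleTransfer

/-!
# `Balaban1983to89.Beta.WindowInterface` — the typed wall's three owed inputs (W1) leg table, (W2) in-window comparison,
(W3) outside-window share, as the hypotheses of ONE theorem (β sub-cell, lead's bookkeeping node BETA-LEAD-WINDOW-INTERFACE;
BETA-SPEC v1.9f §7.12, RULING (R7))

HONEST FRAMING (cell rule, verbatim): discharging `BetaPertH` makes Bałaban's UV stability UNCONDITIONAL — a real
constructive-QFT result; it is NOT the continuum limit and NOT the Clay problem.  (Gloss, BETA-SPEC v1.8d/v1.9b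
l. 17–18, GAPS G-ref2-14 (a) / G-ref2-20 (a), verbatim: «UNCONDITIONAL» in [Balaban1989LargeFieldII] (B16) p. 355's
interval-hypothesis sense ONLY (`FlowStepRuns.p355Unconditional_of_partialSums` keeps `hnodes`); the located leaves
G-adv3-2 (left inequality of (0.1)/(2.50), d = 4), G-adv3-1 (U2 transfer of B14 Cor. 3's lower bound) and `SecondExpLeaf`
REMAIN.  Gloss 2, BETA-SPEC v1.9e, beta-ref C-beta-78, BINDING: «unconditional» = `Beta.Assembly.EventualForm`-unconditional END
statement, NOT «Theorem 2 as printed».)  THIS MODULE DISCHARGES NOTHING of the series and asserts nothing about Bałaban's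
β-functions or kernels: every statement below is about ARBITRARY functions `β0 : ℕ → ℕ → ℝ`, `K : ℕ → ℕ → ℤ⁴ → ℝ` and arbitrary
`BubbleTransfer.Leg` data.  Every declaration is `[folklore]`.  Value = kernel bookkeeping (audit cell `pub-balaban`, β sub-cell,
unit `b2b-balaban-strat-b12` gen 6), NOT summit progress.

WHAT THIS MODULE IS.  The typed wall of the β sub-cell is an3's hypothesis structure
`LargeLWindow.WindowDecomposition β⁰ (leadingIntegrand κ μ ν ∘ toReal) Ch Cg A₁ c M` (κ > 0 expected `= kappaBal N`), to be
inhabited for Bałaban's `β⁰` of [B12] (1.4)/(1.22).  BETA-SPEC v1.9f §7.12 / RULING (R7) reads it as the conjunction of three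
owed analytic inputs, each with constants FREE of the blocking factor `L` and of the step `k`:
* (W1) a LEG TABLE `(s, c, P, Q)` of `BubbleTransfer.Leg`s of total degree `6` whose continuum bubble has the (1.22)-moment
  `κ·T` (`hdeg`, `hval`; for the background-field continuum parts `hval` is an3-g4's `BubbleTransfer.hval_of_bfTable` with
  `κ = kappaBal N`) — rows an1 / an5 (the legs: L-free covariant-gauge propagators and their k-uniform position-space
  asymptotics), an2 (the table);
* (W2) the IN-WINDOW COMPARISON between the actual window integrand `K_{L,k}` and the table's lattice bubble
  `K⁰_{L,k}(w) = w_μ w_ν·lattBubble(L,k;w)`: `|K_{L,k}(w) − K⁰_{L,k}(w)| ≤ D/(‖w‖∞²·L²)` for `w ≠ 0` — the block-averaging /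
  Woodbury correction of the legs, relative size `(‖w‖∞/L)²` (row an5);
* (W3) the OUTSIDE-WINDOW SHARE `|β⁰(L,k) − Σ_{0<‖w‖∞≤M(L)} K_{L,k}(w)| ≤ A₁′` — Ward reorganisation (iv), IR / unit-momentum
  sector, the tail `‖w‖∞ > M(L)`, unit-scale pieces (rows an2 + pv23, item (v)).
This file COMPOSES, by name, an3-g4's `BubbleTransfer.windowDecomposition_of_bubble` (which takes (W1) and ONE slot `hA₁`)
with the lead's `LargeLWindow.Split.rem_of_split` (which splits that slot into (W2) + (W3), the in-window correction costing
`80·D`) into single theorems whose hypotheses are LITERALLY (W1), (W2), (W3) plus the window comparability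
`1 ≤ M(L) ≤ L ≤ c·M(L)`:
* §1 `windowDecomposition_of_interface` (the wall, with `A₁ = A₁′ + 80D`), `af0L_iff_of_interface` ((AF-0-L) ⇔ `0 < κ`),
  `stepBal_le_of_interface` (value form for `κ = kappaBal N`: `stepBal N L − A ≤ β⁰(L,k)` for all `L ≥ 2`, all `k`, with
  `stepBal N L = (11N²/(12π²))·log L` and `A` explicit), `logGrowthLower_of_interface`;
* §2 the same specialised to a background-field table of four legs with continuum parts `c₄|x|⁻²`, `c₄∂_μ∂_ν|x|⁻²`, `c₄∂_μ|x|⁻²`,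
  `c₄∂_ν|x|⁻²` (any lattice realisations within the `Leg` bounds): `windowDecomposition_of_bfInterface`,
  `stepBal_le_of_bfInterface`;
* §3 the `k = 0` free rung of `BubbleTransfer` §8 with the slot split: `stepBal_le_of_freeInterface`;
* §4 CONSISTENCY of the interface: for ANY table and ANY `K` satisfying (W2) relative to it, the model
  `β⁰(L,k) := Σ_{0<‖w‖∞≤M(L)} K_{L,k}(w)` meets (W3) with `A₁′ = 0`, hence the wall (`windowDecomposition_windowSum`) — the three
  hypotheses are jointly satisfiable and (W3) is exactly «everything in β⁰ beyond the window sum of K».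
* §5 (v1.1) `windowDecomposition_of_interface'`: (W2) is only needed ON THE WINDOW `0 < ‖w‖∞ ≤ M(L)` (the comparison
  function is extended by `K⁰` outside — the window sums do not see the extension);
* §6 (v1.1) THE LEG-LEVEL FORM (W2′) ⟹ (W2): if each leg of the actual integrand differs from the table's leg, on the window,
  by `≤ R/(‖w‖∞^{a−2}·L²)` (`a` the leg's degree: `R₀/L²` for a propagator entry, `R₁/(‖w‖∞L²) ≥ R₁/L³`-type for a first
  difference, `R₂/(‖w‖∞²L²)` for a second difference — the shape of a block-averaging / Woodbury correction at scale `L`,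
  row an5's successor target), then the moment-weighted bubble differs from `K⁰` by `≤ D/(‖w‖∞²L²)` with
  `D = Σ_i |c_i|·((A_{P_i}+B_{P_i})S_i + R_i(A_{Q_i}+B_{Q_i}) + R_iS_i)` (`perturbed_product`, `perturbed_bubble`,
  `inWindow_of_legPerturbation`), and the wall follows from (W1) + (W2′) + (W3) (`windowDecomposition_of_legInterface`).
* §7 (v1.2, RULING (R8)) THE (W3) SPLIT.  (W3a) EXTERIOR TAIL: a shellwise bound `|K_{L,k}(w)| ≤ E·(r+1)⁻⁴·q^{r+1}` on the shells
  `‖w‖∞ = r+1 > M` (`0 ≤ q < 1`; for `q = e^{−δ/L}` this is `E‖w‖∞⁻⁴e^{−δ‖w‖∞/L}` — the scale-`L` MASS of the actual, block-constrained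
  legs) gives `|Σ_{M<‖w‖∞≤R} K| ≤ 80E/((M+1)(1−q))` uniformly in `R` (`tail_sum_le_geom`), `≤ 80E(1 + L/δ)/(M+1)` (`tail_sum_le_exp`),
  `≤ 80E(1 + c/δ)` under `L ≤ c·M` (`tail_sum_le`); (W3b) IDENTIFICATION `|β⁰(L,k) − Σ_{0<‖w‖∞≤R} K_{L,k}| ≤ U` for some `R ≥ M(L)`;
  the splitter `hout_of_split` ((W3a) + (W3b) ⟹ (W3) with `A₁′ = T + U`) and the composite `windowDecomposition_of_splitInterface`
  ((W1) + (W2) on the window + (W3a) shellwise + (W3b) ⟹ the wall with `A₁ = 80E(1 + c/δ) + U + 80D`).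
* §8 (v1.3) (W3a) AT LEG LEVEL: shellwise leg bounds beyond the window, one leg of each pair carrying the scale-`L` exponential
  (`|F′_i| ≤ R′_i(r+1)^{−a_{P_i}}·e^{−(δ/L)(r+1)}`, `|G′_i| ≤ S′_i(r+1)^{−a_{Q_i}}`), give the shellwise integrand bound with
  `E = Σ_i |c_i|R′_iS′_i` (`shellBound_of_legDecay`); the all-leg-level composite `windowDecomposition_of_legSplitInterface`
  ((W1) + (W2′) + (W3a-leg) + (W3b) ⟹ the wall) leaves ONLY the table identification and (W3b) above leg level.
* §9 (v1.4) SCALE-FORM ADAPTERS: the rows' natural outputs are SCALE-`L` bounds — `R/L^a` on the window (Woodbury fibre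
  bounds `D₀L⁻²`, `D₁L⁻³`, `D₂L⁻⁴`) and `C·L^{−a}·e^{−(δ₀/L)(r+1)}` beyond it; `windowBound_of_scaleBound` turns the first into the
  (W2′) shape `R/(‖w‖∞^{a−2}L²)` (uses `‖w‖∞ ≤ L`, `a ≥ 2`), `shellBound_of_scaleExp` turns the second into the (W3a-leg) shape
  `R′(r+1)^{−a}e^{−(δ₀/(2L))(r+1)}` with `R′ = C·a!·(2/δ₀)^a` (half the rate pays for the power: `x^a ≤ a!·eˣ`), free of `L`
  (`windowBound_of_scaleBound`, `shellBound_of_scaleExp`).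
What is NOT here: any statement that Bałaban's one-step coefficient `β⁰_{k+1}(L)` and his Ward-reorganised window integrand
satisfy (W1)–(W3) — that is the open analytic content of the β sub-cell (MISSING-B12 §13, BETA-SPEC §6.11/§7.12).

References (CONTEXT ONLY; nothing in this file is cited as a fact): [B12] T. Bałaban, Renormalization group approach to
lattice gauge field theories. I, Commun. Math. Phys. 109 (1987) 249–301 — (1.4), (1.22), Thm 2 p. 259.
-/

namespace Literature.MathematicalPhysics.QuantumFieldTheory.Balaban1983to89.Beta.WindowInterface

open Finset
open Literature.Probability.LatticeModels (annulus)
open Literature.MathematicalPhysics.QuantumFieldTheory.Balaban1983to89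
open Literature.MathematicalPhysics.QuantumFieldTheory.Balaban1983to89.Beta
open Literature.MathematicalPhysics.QuantumFieldTheory.Balaban1983to89.Beta.TransverseStructure (E4)
open Literature.MathematicalPhysics.QuantumFieldTheory.Balaban1983to89.Beta.LeadingCoefficient (leadingIntegrand kappaBal
  kappaBal_pos transverseValue af0L_iff_pos slope_kappaBal)
open Literature.MathematicalPhysics.QuantumFieldTheory.Balaban1983to89.Beta.DyadicShell (Pt toReal supNorm)
open Literature.MathematicalPhysics.QuantumFieldTheory.Balaban1983to89.Beta.LargeLWindow (WindowDecomposition)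
open Literature.MathematicalPhysics.QuantumFieldTheory.Balaban1983to89.Beta.LargeL (LogGrowthLower)
open Literature.MathematicalPhysics.QuantumFieldTheory.Balaban1983to89.Beta.BubbleTransfer

noncomputable section

/-! ## 1. (W1) + (W2) + (W3) ⇒ the wall, the sign form and the value form -/

section Interface

variable {ι : Type*} {s : Finset ι} {c : ι → ℝ} {P Q : ι → Leg}

/-- **THE WINDOW INTERFACE THEOREM.**  (W1) a leg table of total degree `6` with continuum (1.22)-moment `κ·T` (`hdeg`,
`hval`); window comparability `1 ≤ M(L)`, `M(L) ≤ L ≤ c·M(L)`; (W2) the in-window comparison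
`|K_{L,k}(w) − w_μw_ν·lattBubble(L,k;w)| ≤ D/(‖w‖∞²L²)`; (W3) the outside-window share `|β⁰(L,k) − Σ_window K_{L,k}| ≤ A₁′`
⟹ `WindowDecomposition β⁰ (κ·T∘toReal) (|κ|·24 + |κ|·110592) bubbleConst (A₁′ + 80D) c M`.
(`BubbleTransfer.windowDecomposition_of_bubble` ∘ `LargeLWindow.Split.rem_of_split`.) [folklore] -/
theorem windowDecomposition_of_interface (hdeg : ∀ i ∈ s, (P i).a + (Q i).a = 6) {μ ν : Fin 4} {κ : ℝ}
    (hval : ∀ x : E4, x ≠ 0 → x μ * x ν * contBubble s c P Q x = leadingIntegrand κ μ ν x)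
    {β0 : ℕ → ℕ → ℝ} {K : ℕ → ℕ → Pt → ℝ} {A₁' D cc : ℝ} {M : ℕ → ℕ} (hD : 0 ≤ D) (hc : 1 ≤ cc)
    (hM : ∀ L : ℕ, 2 ≤ L → 1 ≤ M L ∧ (L : ℝ) ≤ cc * M L) (hML : ∀ L : ℕ, 2 ≤ L → M L ≤ L)
    (hin : ∀ L : ℕ, 2 ≤ L → ∀ k : ℕ, ∀ w : Pt, w ≠ 0 →
      |K L k w - toReal w μ * toReal w ν * lattBubble s c P Q L k w| ≤ D / ((supNorm w : ℝ) ^ 2 * (L : ℝ) ^ 2))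
    (hout : ∀ L : ℕ, 2 ≤ L → ∀ k : ℕ, |β0 L k - ∑ w ∈ annulus 4 0 (M L), K L k w| ≤ A₁') :
    WindowDecomposition β0 (fun w => leadingIntegrand κ μ ν (toReal w)) (|κ| * 24 + |κ| * 110592)
      (bubbleConst s c P Q) (A₁' + 80 * D) cc M :=
  windowDecomposition_of_bubble hdeg hval hc hM
    (LargeLWindow.Split.rem_of_split (K₀ := fun L k w => toReal w μ * toReal w ν * lattBubble s c P Q L k w)
      hD hML hout hin)

/-- **(AF-0-L) ⇔ `0 < κ` FROM THE INTERFACE** (sign form; `LeadingCoefficient.af0L_iff_pos`). [folklore] -/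
theorem af0L_iff_of_interface (hdeg : ∀ i ∈ s, (P i).a + (Q i).a = 6) {μ ν : Fin 4} {κ : ℝ}
    (hval : ∀ x : E4, x ≠ 0 → x μ * x ν * contBubble s c P Q x = leadingIntegrand κ μ ν x)
    {β0 : ℕ → ℕ → ℝ} {K : ℕ → ℕ → Pt → ℝ} {A₁' D cc : ℝ} {M : ℕ → ℕ} (hD : 0 ≤ D) (hc : 1 ≤ cc)
    (hM : ∀ L : ℕ, 2 ≤ L → 1 ≤ M L ∧ (L : ℝ) ≤ cc * M L) (hML : ∀ L : ℕ, 2 ≤ L → M L ≤ L)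
    (hin : ∀ L : ℕ, 2 ≤ L → ∀ k : ℕ, ∀ w : Pt, w ≠ 0 →
      |K L k w - toReal w μ * toReal w ν * lattBubble s c P Q L k w| ≤ D / ((supNorm w : ℝ) ^ 2 * (L : ℝ) ^ 2))
    (hout : ∀ L : ℕ, 2 ≤ L → ∀ k : ℕ, |β0 L k - ∑ w ∈ annulus 4 0 (M L), K L k w| ≤ A₁') :
    (∃ b A : ℝ, 0 < b ∧ LogGrowthLower β0 b A) ↔ 0 < κ :=
  af0L_iff_pos (windowDecomposition_of_interface hdeg hval hD hc hM hML hin hout)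

/-- **THE VALUE FORM FROM THE INTERFACE**: if the table's continuum (1.22)-moment is Bałaban-normalised,
`κ = kappaBal N = 11N²/(24π⁴)` (`μ ≠ ν`, `N ≠ 0`), then for every `L ≥ 2` and EVERY `k`:
`stepBal N L − A ≤ β⁰(L,k)`, `stepBal N L = (11N²/(12π²))·log L`, with
`A = constA (|κ|·24 + |κ|·110592) bubbleConst (A₁′ + 80D) c (κ·transverseValue)` explicit in the interface constants.
[folklore] -/
theorem stepBal_le_of_interface (hdeg : ∀ i ∈ s, (P i).a + (Q i).a = 6) {μ ν : Fin 4} (hμν : μ ≠ ν) {N : ℝ}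
    (hN : N ≠ 0) (hval : ∀ x : E4, x ≠ 0 → x μ * x ν * contBubble s c P Q x = leadingIntegrand (kappaBal N) μ ν x)
    {β0 : ℕ → ℕ → ℝ} {K : ℕ → ℕ → Pt → ℝ} {A₁' D cc : ℝ} {M : ℕ → ℕ} (hD : 0 ≤ D) (hc : 1 ≤ cc)
    (hM : ∀ L : ℕ, 2 ≤ L → 1 ≤ M L ∧ (L : ℝ) ≤ cc * M L) (hML : ∀ L : ℕ, 2 ≤ L → M L ≤ L)
    (hin : ∀ L : ℕ, 2 ≤ L → ∀ k : ℕ, ∀ w : Pt, w ≠ 0 →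
      |K L k w - toReal w μ * toReal w ν * lattBubble s c P Q L k w| ≤ D / ((supNorm w : ℝ) ^ 2 * (L : ℝ) ^ 2))
    (hout : ∀ L : ℕ, 2 ≤ L → ∀ k : ℕ, |β0 L k - ∑ w ∈ annulus 4 0 (M L), K L k w| ≤ A₁') :
    ∀ L : ℕ, 2 ≤ L → ∀ k : ℕ,
      B12Normalization.stepBal N L - WindowDecomposition.constA (|kappaBal N| * 24 + |kappaBal N| * 110592)
        (bubbleConst s c P Q) (A₁' + 80 * D) cc (kappaBal N * transverseValue) ≤ β0 L k :=
  ShellValue.logGrowthLower_stepBal' (windowDecomposition_of_interface hdeg hval hD hc hM hML hin hout) hN hμν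

/-- The same as a `LogGrowthLower` statement with the printed slope `b = κ·transverseValue/log 2` (`= 11N²/(12π²)` by
`LeadingCoefficient.slope_kappaBal`). [folklore] -/
theorem logGrowthLower_of_interface (hdeg : ∀ i ∈ s, (P i).a + (Q i).a = 6) {μ ν : Fin 4} (hμν : μ ≠ ν) {N : ℝ}
    (hN : N ≠ 0) (hval : ∀ x : E4, x ≠ 0 → x μ * x ν * contBubble s c P Q x = leadingIntegrand (kappaBal N) μ ν x)
    {β0 : ℕ → ℕ → ℝ} {K : ℕ → ℕ → Pt → ℝ} {A₁' D cc : ℝ} {M : ℕ → ℕ} (hD : 0 ≤ D) (hc : 1 ≤ cc)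
    (hM : ∀ L : ℕ, 2 ≤ L → 1 ≤ M L ∧ (L : ℝ) ≤ cc * M L) (hML : ∀ L : ℕ, 2 ≤ L → M L ≤ L)
    (hin : ∀ L : ℕ, 2 ≤ L → ∀ k : ℕ, ∀ w : Pt, w ≠ 0 →
      |K L k w - toReal w μ * toReal w ν * lattBubble s c P Q L k w| ≤ D / ((supNorm w : ℝ) ^ 2 * (L : ℝ) ^ 2))
    (hout : ∀ L : ℕ, 2 ≤ L → ∀ k : ℕ, |β0 L k - ∑ w ∈ annulus 4 0 (M L), K L k w| ≤ A₁') :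
    LogGrowthLower β0 (kappaBal N * transverseValue / Real.log 2)
      (WindowDecomposition.constA (|kappaBal N| * 24 + |kappaBal N| * 110592) (bubbleConst s c P Q) (A₁' + 80 * D) cc
        (kappaBal N * transverseValue)) := by
  intro L hL k
  rw [slope_kappaBal]
  exact stepBal_le_of_interface hdeg hμν hN hval hD hc hM hML hin hout L hL k

/-- (AF-0-L) holds under the Bałaban-normalised interface: `∃ b > 0, ∃ A, LogGrowthLower β⁰ b A` (`N ≠ 0`; the sign
form does not need `μ ≠ ν`). [folklore] -/
theorem af0L_of_interface (hdeg : ∀ i ∈ s, (P i).a + (Q i).a = 6) {μ ν : Fin 4} {N : ℝ}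
    (hN : N ≠ 0) (hval : ∀ x : E4, x ≠ 0 → x μ * x ν * contBubble s c P Q x = leadingIntegrand (kappaBal N) μ ν x)
    {β0 : ℕ → ℕ → ℝ} {K : ℕ → ℕ → Pt → ℝ} {A₁' D cc : ℝ} {M : ℕ → ℕ} (hD : 0 ≤ D) (hc : 1 ≤ cc)
    (hM : ∀ L : ℕ, 2 ≤ L → 1 ≤ M L ∧ (L : ℝ) ≤ cc * M L) (hML : ∀ L : ℕ, 2 ≤ L → M L ≤ L)
    (hin : ∀ L : ℕ, 2 ≤ L → ∀ k : ℕ, ∀ w : Pt, w ≠ 0 →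
      |K L k w - toReal w μ * toReal w ν * lattBubble s c P Q L k w| ≤ D / ((supNorm w : ℝ) ^ 2 * (L : ℝ) ^ 2))
    (hout : ∀ L : ℕ, 2 ≤ L → ∀ k : ℕ, |β0 L k - ∑ w ∈ annulus 4 0 (M L), K L k w| ≤ A₁') :
    ∃ b A : ℝ, 0 < b ∧ LogGrowthLower β0 b A :=
  (af0L_iff_of_interface hdeg hval hD hc hM hML hin hout).mpr (kappaBal_pos hN)

end Interface

/-! ## 2. The background-field table: four legs with the continuum parts `c₄|x|⁻²`, `c₄∂_μ∂_ν|x|⁻²`, `c₄∂_μ|x|⁻²`, `c₄∂_ν|x|⁻²` -/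

section BfTable

variable {μ ν : Fin 4} {N : ℝ} {P₀ H Dμ Dν : Leg}

/-- The degree hypothesis of the two-term background-field table from the four legs' degrees. [folklore] -/
theorem hdeg_bfTable (ha₁ : P₀.a + H.a = 6) (ha₂ : Dμ.a + Dν.a = 6) :
    ∀ i ∈ (Finset.univ : Finset (Fin 2)), (![P₀, Dμ] i).a + (![H, Dν] i).a = 6 := by
  intro i _
  fin_cases i
  · simpa using ha₁
  · simpa using ha₂

/-- **THE WALL FROM THE BACKGROUND-FIELD INTERFACE**: four legs with the background-field continuum parts and total degrees
`6` (any lattice realisations `f L k` within the `Leg` bounds — the k-th rung's propagator entries and covariant differences),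
(W2) relative to the table `![2N·N·6, 2N·N·10], ![P₀, Dμ], ![H, Dν]`, (W3), window comparability ⟹ the wall with
`κ = kappaBal N`. [folklore] -/
theorem windowDecomposition_of_bfInterface (hμν : μ ≠ ν) (N : ℝ)
    (hP₀ : ∀ x, P₀.ℓ x = c4 * invSq x) (hH : ∀ x, H.ℓ x = c4 * hessInvSq μ ν x)
    (hDμ : ∀ x, Dμ.ℓ x = c4 * d1InvSq μ x) (hDν : ∀ x, Dν.ℓ x = c4 * d1InvSq ν x)
    (ha₁ : P₀.a + H.a = 6) (ha₂ : Dμ.a + Dν.a = 6)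
    {β0 : ℕ → ℕ → ℝ} {K : ℕ → ℕ → Pt → ℝ} {A₁' D cc : ℝ} {M : ℕ → ℕ} (hD : 0 ≤ D) (hc : 1 ≤ cc)
    (hM : ∀ L : ℕ, 2 ≤ L → 1 ≤ M L ∧ (L : ℝ) ≤ cc * M L) (hML : ∀ L : ℕ, 2 ≤ L → M L ≤ L)
    (hin : ∀ L : ℕ, 2 ≤ L → ∀ k : ℕ, ∀ w : Pt, w ≠ 0 →
      |K L k w - toReal w μ * toReal w ν *
          lattBubble Finset.univ ![2 * N * N * 6, 2 * N * N * 10] ![P₀, Dμ] ![H, Dν] L k w| ≤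
        D / ((supNorm w : ℝ) ^ 2 * (L : ℝ) ^ 2))
    (hout : ∀ L : ℕ, 2 ≤ L → ∀ k : ℕ, |β0 L k - ∑ w ∈ annulus 4 0 (M L), K L k w| ≤ A₁') :
    WindowDecomposition β0 (fun w => leadingIntegrand (kappaBal N) μ ν (toReal w))
      (|kappaBal N| * 24 + |kappaBal N| * 110592)
      (bubbleConst Finset.univ ![2 * N * N * 6, 2 * N * N * 10] ![P₀, Dμ] ![H, Dν]) (A₁' + 80 * D) cc M :=
  windowDecomposition_of_interface (hdeg_bfTable ha₁ ha₂) (hval_of_bfTable hμν N P₀ H Dμ Dν hP₀ hH hDμ hDν) hD hc hM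
    hML hin hout

/-- **THE VALUE FORM FROM THE BACKGROUND-FIELD INTERFACE**: `stepBal N L − A ≤ β⁰(L,k)` for every `L ≥ 2`, every `k`
(`N ≠ 0`). [folklore] -/
theorem stepBal_le_of_bfInterface (hμν : μ ≠ ν) (hN : N ≠ 0)
    (hP₀ : ∀ x, P₀.ℓ x = c4 * invSq x) (hH : ∀ x, H.ℓ x = c4 * hessInvSq μ ν x)
    (hDμ : ∀ x, Dμ.ℓ x = c4 * d1InvSq μ x) (hDν : ∀ x, Dν.ℓ x = c4 * d1InvSq ν x)
    (ha₁ : P₀.a + H.a = 6) (ha₂ : Dμ.a + Dν.a = 6)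
    {β0 : ℕ → ℕ → ℝ} {K : ℕ → ℕ → Pt → ℝ} {A₁' D cc : ℝ} {M : ℕ → ℕ} (hD : 0 ≤ D) (hc : 1 ≤ cc)
    (hM : ∀ L : ℕ, 2 ≤ L → 1 ≤ M L ∧ (L : ℝ) ≤ cc * M L) (hML : ∀ L : ℕ, 2 ≤ L → M L ≤ L)
    (hin : ∀ L : ℕ, 2 ≤ L → ∀ k : ℕ, ∀ w : Pt, w ≠ 0 →
      |K L k w - toReal w μ * toReal w ν *
          lattBubble Finset.univ ![2 * N * N * 6, 2 * N * N * 10] ![P₀, Dμ] ![H, Dν] L k w| ≤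
        D / ((supNorm w : ℝ) ^ 2 * (L : ℝ) ^ 2))
    (hout : ∀ L : ℕ, 2 ≤ L → ∀ k : ℕ, |β0 L k - ∑ w ∈ annulus 4 0 (M L), K L k w| ≤ A₁') :
    ∀ L : ℕ, 2 ≤ L → ∀ k : ℕ,
      B12Normalization.stepBal N L - WindowDecomposition.constA (|kappaBal N| * 24 + |kappaBal N| * 110592)
        (bubbleConst Finset.univ ![2 * N * N * 6, 2 * N * N * 10] ![P₀, Dμ] ![H, Dν]) (A₁' + 80 * D) cc
          (kappaBal N * transverseValue) ≤ β0 L k :=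
  stepBal_le_of_interface (hdeg_bfTable ha₁ ha₂) hμν hN (hval_of_bfTable hμν N P₀ H Dμ Dν hP₀ hH hDμ hDν) hD hc hM
    hML hin hout

end BfTable

/-! ## 3. The `k = 0` free rung (BubbleTransfer §8) with the slot split -/

section FreeRung

/-- **THE FREE RUNG WITH THE SPLIT SLOT**: the free background-field table at `k = 0` (legs `latticeGreen/2`,
`∇⁺ latticeGreen/2`, polarised second differences under three instances of Lawler (1.37)), (W2) relative to it, (W3), window
comparability ⟹ `stepBal N L − A ≤ β⁰(L,k)`.  (`BubbleTransfer.hval_freeTable` + §1.) [folklore] -/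
theorem stepBal_le_of_freeInterface {μ ν : Fin 4} (hμν : μ ≠ ν) {N : ℝ} (hN : N ≠ 0) {K₁ : ℝ} (hK : 0 ≤ K₁)
    (h₁ : Lawler137Shape (unitVec μ + unitVec ν) K₁) (h₂ : Lawler137Shape (unitVec μ) K₁)
    (h₃ : Lawler137Shape (unitVec ν) K₁)
    {β0 : ℕ → ℕ → ℝ} {K : ℕ → ℕ → Pt → ℝ} {A₁' D cc : ℝ} {M : ℕ → ℕ} (hD : 0 ≤ D) (hc : 1 ≤ cc)
    (hM : ∀ L : ℕ, 2 ≤ L → 1 ≤ M L ∧ (L : ℝ) ≤ cc * M L) (hML : ∀ L : ℕ, 2 ≤ L → M L ≤ L)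
    (hin : ∀ L : ℕ, 2 ≤ L → ∀ k : ℕ, ∀ w : Pt, w ≠ 0 →
      |K L k w - toReal w μ * toReal w ν *
          lattBubble Finset.univ ![2 * N * N * 6, 2 * N * N * 10] ![freeLeg, gradLegFwd μ]
            ![mixedHessLeg μ ν hK h₁ h₂ h₃, gradLegFwd ν] L k w| ≤ D / ((supNorm w : ℝ) ^ 2 * (L : ℝ) ^ 2))
    (hout : ∀ L : ℕ, 2 ≤ L → ∀ k : ℕ, |β0 L k - ∑ w ∈ annulus 4 0 (M L), K L k w| ≤ A₁') :
    ∀ L : ℕ, 2 ≤ L → ∀ k : ℕ,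
      B12Normalization.stepBal N L - WindowDecomposition.constA (|kappaBal N| * 24 + |kappaBal N| * 110592)
        (bubbleConst Finset.univ ![2 * N * N * 6, 2 * N * N * 10] ![freeLeg, gradLegFwd μ]
          ![mixedHessLeg μ ν hK h₁ h₂ h₃, gradLegFwd ν]) (A₁' + 80 * D) cc (kappaBal N * transverseValue) ≤ β0 L k :=
  stepBal_le_of_interface (hval_freeTable hμν N hK h₁ h₂ h₃).1 hμν hN (hval_freeTable hμν N hK h₁ h₂ h₃).2 hD hc hM hML
    hin hout

end FreeRung

/-! ## 4. Consistency: the window sum of ANY `K` satisfying (W2) meets (W3) with `A₁′ = 0`, hence the wall -/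

section Consistency

variable {ι : Type*} {s : Finset ι} {c : ι → ℝ} {P Q : ι → Leg}

/-- For the MODEL coefficient `β⁰(L,k) := Σ_{0<‖w‖∞≤M(L)} K_{L,k}(w)` the outside-window share (W3) vanishes, so (W1) + (W2)
alone give the wall with `A₁ = 80D` — the interface hypotheses are jointly satisfiable for every table and every in-window
perturbation of its bubble, and (W3) measures exactly what `β⁰` contains beyond the window sum of `K`. [folklore] -/
theorem windowDecomposition_windowSum (hdeg : ∀ i ∈ s, (P i).a + (Q i).a = 6) {μ ν : Fin 4} {κ : ℝ}
    (hval : ∀ x : E4, x ≠ 0 → x μ * x ν * contBubble s c P Q x = leadingIntegrand κ μ ν x)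
    {K : ℕ → ℕ → Pt → ℝ} {D cc : ℝ} {M : ℕ → ℕ} (hD : 0 ≤ D) (hc : 1 ≤ cc)
    (hM : ∀ L : ℕ, 2 ≤ L → 1 ≤ M L ∧ (L : ℝ) ≤ cc * M L) (hML : ∀ L : ℕ, 2 ≤ L → M L ≤ L)
    (hin : ∀ L : ℕ, 2 ≤ L → ∀ k : ℕ, ∀ w : Pt, w ≠ 0 →
      |K L k w - toReal w μ * toReal w ν * lattBubble s c P Q L k w| ≤ D / ((supNorm w : ℝ) ^ 2 * (L : ℝ) ^ 2)) :
    WindowDecomposition (fun L k => ∑ w ∈ annulus 4 0 (M L), K L k w) (fun w => leadingIntegrand κ μ ν (toReal w))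
      (|κ| * 24 + |κ| * 110592) (bubbleConst s c P Q) (0 + 80 * D) cc M :=
  windowDecomposition_of_interface hdeg hval hD hc hM hML hin fun L _ k => by simp

/-- In particular with `K = K⁰` itself (`D = 0`) and the identity window `M(L) = L`, `c = 1`: the table's own window sums
admit the wall with `A₁ = 0` — (W1) alone is consistent with the conclusion. [folklore] -/
theorem windowDecomposition_bubbleSum (hdeg : ∀ i ∈ s, (P i).a + (Q i).a = 6) {μ ν : Fin 4} {κ : ℝ}
    (hval : ∀ x : E4, x ≠ 0 → x μ * x ν * contBubble s c P Q x = leadingIntegrand κ μ ν x) :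
    WindowDecomposition (fun L k => ∑ w ∈ annulus 4 0 L, toReal w μ * toReal w ν * lattBubble s c P Q L k w)
      (fun w => leadingIntegrand κ μ ν (toReal w)) (|κ| * 24 + |κ| * 110592) (bubbleConst s c P Q) (0 + 80 * 0) 1 id :=
  windowDecomposition_windowSum (K := fun L k w => toReal w μ * toReal w ν * lattBubble s c P Q L k w) (M := id) hdeg hval
    le_rfl le_rfl (fun L hL => ⟨by show 1 ≤ L; omega, by simp⟩) (fun L _ => le_rfl)
    (fun L _ k w _ => by simp)

end Consistency

/-! ## 5. (v1.1) (W2) is only needed on the window -/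

section WindowOnly

variable {ι : Type*} {s : Finset ι} {c : ι → ℝ} {P Q : ι → Leg}

/-- **THE INTERFACE THEOREM WITH (W2) ON THE WINDOW ONLY**: the in-window comparison need only hold for
`w ∈ annulus 4 0 (M L)` (`0 < ‖w‖∞ ≤ M(L)`); the proof extends `K` by `K⁰` off the window, which changes neither the window
sums in (W3) nor the conclusion. [folklore] -/
theorem windowDecomposition_of_interface' (hdeg : ∀ i ∈ s, (P i).a + (Q i).a = 6) {μ ν : Fin 4} {κ : ℝ}
    (hval : ∀ x : E4, x ≠ 0 → x μ * x ν * contBubble s c P Q x = leadingIntegrand κ μ ν x)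
    {β0 : ℕ → ℕ → ℝ} {K : ℕ → ℕ → Pt → ℝ} {A₁' D cc : ℝ} {M : ℕ → ℕ} (hD : 0 ≤ D) (hc : 1 ≤ cc)
    (hM : ∀ L : ℕ, 2 ≤ L → 1 ≤ M L ∧ (L : ℝ) ≤ cc * M L) (hML : ∀ L : ℕ, 2 ≤ L → M L ≤ L)
    (hin : ∀ L : ℕ, 2 ≤ L → ∀ k : ℕ, ∀ w ∈ annulus 4 0 (M L),
      |K L k w - toReal w μ * toReal w ν * lattBubble s c P Q L k w| ≤ D / ((supNorm w : ℝ) ^ 2 * (L : ℝ) ^ 2))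
    (hout : ∀ L : ℕ, 2 ≤ L → ∀ k : ℕ, |β0 L k - ∑ w ∈ annulus 4 0 (M L), K L k w| ≤ A₁') :
    WindowDecomposition β0 (fun w => leadingIntegrand κ μ ν (toReal w)) (|κ| * 24 + |κ| * 110592)
      (bubbleConst s c P Q) (A₁' + 80 * D) cc M := by
  classical
  let K' : ℕ → ℕ → Pt → ℝ := fun L k w =>
    if w ∈ annulus 4 0 (M L) then K L k w else toReal w μ * toReal w ν * lattBubble s c P Q L k w
  have hin' : ∀ L : ℕ, 2 ≤ L → ∀ k : ℕ, ∀ w : Pt, w ≠ 0 →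
      |K' L k w - toReal w μ * toReal w ν * lattBubble s c P Q L k w| ≤ D / ((supNorm w : ℝ) ^ 2 * (L : ℝ) ^ 2) := by
    intro L hL k w hw
    by_cases hmem : w ∈ annulus 4 0 (M L)
    · simp only [K', if_pos hmem]
      exact hin L hL k w hmem
    · simp only [K', if_neg hmem, sub_self, abs_zero]
      positivity
  have hout' : ∀ L : ℕ, 2 ≤ L → ∀ k : ℕ, |β0 L k - ∑ w ∈ annulus 4 0 (M L), K' L k w| ≤ A₁' := by
    intro L hL k
    have e : ∑ w ∈ annulus 4 0 (M L), K' L k w = ∑ w ∈ annulus 4 0 (M L), K L k w :=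
      Finset.sum_congr rfl fun w hw => by simp only [K', if_pos hw]
    rw [e]
    exact hout L hL k
  exact windowDecomposition_of_interface hdeg hval hD hc hM hML hin' hout'

end WindowOnly

/-! ## 6. (v1.1) (W2) from LEG-LEVEL in-window perturbations — the adapter for scale-`L` corrections of the legs -/

section LegPerturbation

/-- Exponent bookkeeping: total degree `6` leaves at least `4` after removing the `L⁻²`-gain's two powers from one leg.
[folklore] -/
theorem four_le_deg_left {a b : ℕ} (h : a + b = 6) : 4 ≤ a + (b - 2) := by omega

/-- The symmetric statement. [folklore] -/
theorem four_le_deg_right {a b : ℕ} (h : a + b = 6) : 4 ≤ (a - 2) + b := by omega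

/-- And at least `2` after removing two powers from both legs. [folklore] -/
theorem two_le_deg_both {a b : ℕ} (h : a + b = 6) : 2 ≤ (a - 2) + (b - 2) := by omega

/-- **ONE LEG PAIR.**  If, at a window point `w` (`0 < ‖w‖∞ ≤ L`), the actual legs `f′, g′` differ from the table legs
`P.f, Q.f` (total degree `6`) by `≤ R/(‖w‖∞^{a_P−2}L²)` and `≤ S/(‖w‖∞^{a_Q−2}L²)`, then
`|f′g′ − P.f·Q.f| ≤ ((A_P+B_P)S + R(A_Q+B_Q) + RS)/(‖w‖∞⁴L²)`. [folklore] -/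
theorem perturbed_product (P Q : Leg) (hdeg : P.a + Q.a = 6) {L k : ℕ} {w : Pt} (hw : w ≠ 0)
    (hwL : (supNorm w : ℝ) ≤ L) {f' g' R S : ℝ} (hR : 0 ≤ R) (hS : 0 ≤ S)
    (hf : |f' - P.f L k w| ≤ R / ((supNorm w : ℝ) ^ (P.a - 2) * (L : ℝ) ^ 2))
    (hg : |g' - Q.f L k w| ≤ S / ((supNorm w : ℝ) ^ (Q.a - 2) * (L : ℝ) ^ 2)) :
    |f' * g' - P.f L k w * Q.f L k w| ≤
      ((P.A + P.B) * S + R * (Q.A + Q.B) + R * S) / ((supNorm w : ℝ) ^ 4 * (L : ℝ) ^ 2) := by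
  have hs : (1 : ℝ) ≤ supNorm w := Leg.one_le_supNorm hw
  have hs0 : (0 : ℝ) < supNorm w := by linarith
  have hL0 : (0 : ℝ) < L := by linarith
  have hPA := P.nonneg_A; have hPB := P.nonneg_B; have hQA := Q.nonneg_A; have hQB := Q.nonneg_B
  set σ : ℝ := (supNorm w : ℝ) with hσ
  have hfP : |P.f L k w| ≤ (P.A + P.B) / σ ^ P.a := P.abs_f_le L k hw
  have hfQ : |Q.f L k w| ≤ (Q.A + Q.B) / σ ^ Q.a := Q.abs_f_le L k hw
  -- term 1: `|P.f|·|g′ − Q.f|`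
  have T1 : |P.f L k w| * |g' - Q.f L k w| ≤ (P.A + P.B) * S / (σ ^ 4 * (L : ℝ) ^ 2) := by
    calc |P.f L k w| * |g' - Q.f L k w| ≤ (P.A + P.B) / σ ^ P.a * (S / (σ ^ (Q.a - 2) * (L : ℝ) ^ 2)) :=
          mul_le_mul hfP hg (abs_nonneg _) (by positivity)
      _ = (P.A + P.B) * S / (σ ^ (P.a + (Q.a - 2)) * (L : ℝ) ^ 2) := by rw [div_mul_div_comm, pow_add]; ring
      _ ≤ (P.A + P.B) * S / (σ ^ 4 * (L : ℝ) ^ 2) := by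
          apply div_le_div_of_nonneg_left (by positivity) (by positivity)
          exact mul_le_mul_of_nonneg_right (pow_le_pow_right₀ hs (four_le_deg_left hdeg)) (by positivity)
  -- term 2: `|f′ − P.f|·|Q.f|`
  have T2 : |f' - P.f L k w| * |Q.f L k w| ≤ R * (Q.A + Q.B) / (σ ^ 4 * (L : ℝ) ^ 2) := by
    calc |f' - P.f L k w| * |Q.f L k w| ≤ R / (σ ^ (P.a - 2) * (L : ℝ) ^ 2) * ((Q.A + Q.B) / σ ^ Q.a) :=
          mul_le_mul hf hfQ (abs_nonneg _) (by positivity)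
      _ = R * (Q.A + Q.B) / (σ ^ ((P.a - 2) + Q.a) * (L : ℝ) ^ 2) := by rw [div_mul_div_comm, pow_add]; ring
      _ ≤ R * (Q.A + Q.B) / (σ ^ 4 * (L : ℝ) ^ 2) := by
          apply div_le_div_of_nonneg_left (by positivity) (by positivity)
          exact mul_le_mul_of_nonneg_right (pow_le_pow_right₀ hs (four_le_deg_right hdeg)) (by positivity)
  -- term 3: `|f′ − P.f|·|g′ − Q.f|` (uses `‖w‖∞ ≤ L` once)
  have T3 : |f' - P.f L k w| * |g' - Q.f L k w| ≤ R * S / (σ ^ 4 * (L : ℝ) ^ 2) := by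
    have h1 : σ ^ 2 ≤ σ ^ ((P.a - 2) + (Q.a - 2)) := pow_le_pow_right₀ hs (two_le_deg_both hdeg)
    have h2 : σ ^ 2 ≤ (L : ℝ) ^ 2 := pow_le_pow_left₀ hs0.le hwL 2
    have h3 : σ ^ 4 * (L : ℝ) ^ 2 ≤ σ ^ ((P.a - 2) + (Q.a - 2)) * ((L : ℝ) ^ 2 * (L : ℝ) ^ 2) := by
      calc σ ^ 4 * (L : ℝ) ^ 2 = σ ^ 2 * (σ ^ 2 * (L : ℝ) ^ 2) := by ring
        _ ≤ σ ^ ((P.a - 2) + (Q.a - 2)) * ((L : ℝ) ^ 2 * (L : ℝ) ^ 2) :=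
            mul_le_mul h1 (mul_le_mul_of_nonneg_right h2 (by positivity)) (by positivity) (by positivity)
    calc |f' - P.f L k w| * |g' - Q.f L k w|
          ≤ R / (σ ^ (P.a - 2) * (L : ℝ) ^ 2) * (S / (σ ^ (Q.a - 2) * (L : ℝ) ^ 2)) :=
          mul_le_mul hf hg (abs_nonneg _) (by positivity)
      _ = R * S / (σ ^ ((P.a - 2) + (Q.a - 2)) * ((L : ℝ) ^ 2 * (L : ℝ) ^ 2)) := by
          rw [div_mul_div_comm, pow_add]; ring
      _ ≤ R * S / (σ ^ 4 * (L : ℝ) ^ 2) := div_le_div_of_nonneg_left (by positivity) (by positivity) h3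
  have key : f' * g' - P.f L k w * Q.f L k w =
      P.f L k w * (g' - Q.f L k w) + (f' - P.f L k w) * Q.f L k w + (f' - P.f L k w) * (g' - Q.f L k w) := by ring
  rw [key]
  calc |P.f L k w * (g' - Q.f L k w) + (f' - P.f L k w) * Q.f L k w + (f' - P.f L k w) * (g' - Q.f L k w)|
        ≤ |P.f L k w * (g' - Q.f L k w)| + |(f' - P.f L k w) * Q.f L k w| + |(f' - P.f L k w) * (g' - Q.f L k w)| :=
        abs_add_three _ _ _
    _ = |P.f L k w| * |g' - Q.f L k w| + |f' - P.f L k w| * |Q.f L k w| + |f' - P.f L k w| * |g' - Q.f L k w| := by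
        simp only [abs_mul]
    _ ≤ (P.A + P.B) * S / (σ ^ 4 * (L : ℝ) ^ 2) + R * (Q.A + Q.B) / (σ ^ 4 * (L : ℝ) ^ 2)
          + R * S / (σ ^ 4 * (L : ℝ) ^ 2) := add_le_add (add_le_add T1 T2) T3
    _ = ((P.A + P.B) * S + R * (Q.A + Q.B) + R * S) / (σ ^ 4 * (L : ℝ) ^ 2) := by ring

variable {ι : Type*} {s : Finset ι} {c : ι → ℝ} {P Q : ι → Leg}

/-- **THE PERTURBED BUBBLE.**  Leg-level in-window perturbations ⟹ the bubble moves by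
`≤ (Σ_i |c_i|·((A_{P_i}+B_{P_i})S_i + R_i(A_{Q_i}+B_{Q_i}) + R_iS_i))/(‖w‖∞⁴L²)`. [folklore] -/
theorem perturbed_bubble (hdeg : ∀ i ∈ s, (P i).a + (Q i).a = 6) {L k : ℕ} {w : Pt} (hw : w ≠ 0)
    (hwL : (supNorm w : ℝ) ≤ L) {f' g' R S : ι → ℝ} (hR : ∀ i ∈ s, 0 ≤ R i) (hS : ∀ i ∈ s, 0 ≤ S i)
    (hf : ∀ i ∈ s, |f' i - (P i).f L k w| ≤ R i / ((supNorm w : ℝ) ^ ((P i).a - 2) * (L : ℝ) ^ 2))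
    (hg : ∀ i ∈ s, |g' i - (Q i).f L k w| ≤ S i / ((supNorm w : ℝ) ^ ((Q i).a - 2) * (L : ℝ) ^ 2)) :
    |∑ i ∈ s, c i * (f' i * g' i) - lattBubble s c P Q L k w| ≤
      (∑ i ∈ s, |c i| * ((((P i).A + (P i).B) * S i + R i * ((Q i).A + (Q i).B) + R i * S i))) /
        ((supNorm w : ℝ) ^ 4 * (L : ℝ) ^ 2) := by
  rw [lattBubble, ← Finset.sum_sub_distrib, Finset.sum_div]
  refine (Finset.abs_sum_le_sum_abs _ _).trans (Finset.sum_le_sum fun i hi => ?_)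
  rw [← mul_sub, abs_mul, mul_div_assoc]
  exact mul_le_mul_of_nonneg_left (perturbed_product (P i) (Q i) (hdeg i hi) hw hwL (hR i hi) (hS i hi) (hf i hi) (hg i hi))
    (abs_nonneg _)

/-- **(W2′) ⟹ (W2) AT A WINDOW POINT**: with the (1.22)-moment weight `|w_μw_ν| ≤ ‖w‖∞²` the perturbed moment integrand is
within `D/(‖w‖∞²L²)` of `K⁰ = w_μw_ν·lattBubble`. [folklore] -/
theorem inWindow_of_legPerturbation (hdeg : ∀ i ∈ s, (P i).a + (Q i).a = 6) (μ ν : Fin 4) {L k : ℕ} {w : Pt}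
    (hw : w ≠ 0) (hwL : (supNorm w : ℝ) ≤ L) {f' g' R S : ι → ℝ} (hR : ∀ i ∈ s, 0 ≤ R i) (hS : ∀ i ∈ s, 0 ≤ S i)
    (hf : ∀ i ∈ s, |f' i - (P i).f L k w| ≤ R i / ((supNorm w : ℝ) ^ ((P i).a - 2) * (L : ℝ) ^ 2))
    (hg : ∀ i ∈ s, |g' i - (Q i).f L k w| ≤ S i / ((supNorm w : ℝ) ^ ((Q i).a - 2) * (L : ℝ) ^ 2)) :
    |toReal w μ * toReal w ν * ∑ i ∈ s, c i * (f' i * g' i) - toReal w μ * toReal w ν * lattBubble s c P Q L k w| ≤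
      (∑ i ∈ s, |c i| * ((((P i).A + (P i).B) * S i + R i * ((Q i).A + (Q i).B) + R i * S i))) /
        ((supNorm w : ℝ) ^ 2 * (L : ℝ) ^ 2) := by
  have hs : (1 : ℝ) ≤ supNorm w := Leg.one_le_supNorm hw
  have hL0 : (0 : ℝ) < L := by linarith
  have hDnn : 0 ≤ ∑ i ∈ s, |c i| * ((((P i).A + (P i).B) * S i + R i * ((Q i).A + (Q i).B) + R i * S i)) := by
    refine Finset.sum_nonneg fun i hi => mul_nonneg (abs_nonneg _) ?_
    have := (P i).nonneg_A; have := (P i).nonneg_B; have := (Q i).nonneg_A; have := (Q i).nonneg_B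
    have := hR i hi; have := hS i hi
    positivity
  set D : ℝ := ∑ i ∈ s, |c i| * ((((P i).A + (P i).B) * S i + R i * ((Q i).A + (Q i).B) + R i * S i)) with hD
  rw [← mul_sub, abs_mul]
  calc |toReal w μ * toReal w ν| * |∑ i ∈ s, c i * (f' i * g' i) - lattBubble s c P Q L k w|
        ≤ (supNorm w : ℝ) ^ 2 * (D / ((supNorm w : ℝ) ^ 4 * (L : ℝ) ^ 2)) :=
        mul_le_mul (abs_moment_le μ ν w) (perturbed_bubble hdeg hw hwL hR hS hf hg) (abs_nonneg _) (by positivity)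
    _ = D / ((supNorm w : ℝ) ^ 2 * (L : ℝ) ^ 2) := by
        field_simp

/-- **THE WALL FROM (W1) + (W2′) + (W3).**  Actual legs `F′ i, G′ i : ℕ → ℕ → ℤ⁴ → ℝ` that differ from the table legs ON THE
WINDOW by `≤ R_i/(‖w‖∞^{a−2}L²)`, `≤ S_i/(‖w‖∞^{a−2}L²)`; the actual window integrand
`K_{L,k}(w) := w_μw_ν·Σ_i c_i F′_i G′_i`; (W3) for this `K` ⟹ the wall with `A₁ = A₁′ + 80·D`. [folklore] -/
theorem windowDecomposition_of_legInterface (hdeg : ∀ i ∈ s, (P i).a + (Q i).a = 6) {μ ν : Fin 4} {κ : ℝ}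
    (hval : ∀ x : E4, x ≠ 0 → x μ * x ν * contBubble s c P Q x = leadingIntegrand κ μ ν x)
    {β0 : ℕ → ℕ → ℝ} {F' G' : ι → ℕ → ℕ → Pt → ℝ} {R S : ι → ℝ} {A₁' cc : ℝ} {M : ℕ → ℕ}
    (hR : ∀ i ∈ s, 0 ≤ R i) (hS : ∀ i ∈ s, 0 ≤ S i) (hc : 1 ≤ cc)
    (hM : ∀ L : ℕ, 2 ≤ L → 1 ≤ M L ∧ (L : ℝ) ≤ cc * M L) (hML : ∀ L : ℕ, 2 ≤ L → M L ≤ L)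
    (hF : ∀ L : ℕ, 2 ≤ L → ∀ k : ℕ, ∀ w ∈ annulus 4 0 (M L), ∀ i ∈ s,
      |F' i L k w - (P i).f L k w| ≤ R i / ((supNorm w : ℝ) ^ ((P i).a - 2) * (L : ℝ) ^ 2))
    (hG : ∀ L : ℕ, 2 ≤ L → ∀ k : ℕ, ∀ w ∈ annulus 4 0 (M L), ∀ i ∈ s,
      |G' i L k w - (Q i).f L k w| ≤ S i / ((supNorm w : ℝ) ^ ((Q i).a - 2) * (L : ℝ) ^ 2))
    (hout : ∀ L : ℕ, 2 ≤ L → ∀ k : ℕ,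
      |β0 L k - ∑ w ∈ annulus 4 0 (M L), toReal w μ * toReal w ν * ∑ i ∈ s, c i * (F' i L k w * G' i L k w)| ≤ A₁') :
    WindowDecomposition β0 (fun w => leadingIntegrand κ μ ν (toReal w)) (|κ| * 24 + |κ| * 110592) (bubbleConst s c P Q)
      (A₁' + 80 * ∑ i ∈ s, |c i| * ((((P i).A + (P i).B) * S i + R i * ((Q i).A + (Q i).B) + R i * S i))) cc M := by
  have hDnn : 0 ≤ ∑ i ∈ s, |c i| * ((((P i).A + (P i).B) * S i + R i * ((Q i).A + (Q i).B) + R i * S i)) := by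
    refine Finset.sum_nonneg fun i hi => mul_nonneg (abs_nonneg _) ?_
    have := (P i).nonneg_A; have := (P i).nonneg_B; have := (Q i).nonneg_A; have := (Q i).nonneg_B
    have := hR i hi; have := hS i hi
    positivity
  refine windowDecomposition_of_interface' (K := fun L k w => toReal w μ * toReal w ν * ∑ i ∈ s, c i * (F' i L k w * G' i L k w))
    hdeg hval hDnn hc hM hML (fun L hL k w hw => ?_) hout
  have hw0 : w ≠ 0 := DyadicShell.ne_zero_of_mem_annulus hw
  have hwM : supNorm w ≤ M L := (DyadicShell.mem_annulus_iff.mp hw).2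
  have hwL : (supNorm w : ℝ) ≤ L := by exact_mod_cast hwM.trans (hML L hL)
  exact inWindow_of_legPerturbation hdeg μ ν hw0 hwL hR hS (fun i hi => hF L hL k w hw i hi) (fun i hi => hG L hL k w hw i hi)

end LegPerturbation

/-! ## 7. (v1.2, RULING (R8)) The (W3) split: (W3a) an exterior-tail summation lemma + (W3b) identification ⟹ (W3) -/

section Tail

open Literature.MathematicalPhysics.QuantumFieldTheory.Balaban1983to89.Beta.DyadicShell (sum_Ico_shellSum)
open Literature.MathematicalPhysics.QuantumFieldTheory.Balaban1983to89.Beta.WindowLog (shellSum)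
open Literature.MathematicalPhysics.QuantumFieldTheory.Balaban1983to89.Beta.TransferUV (card_annulus_succ_four_le)

/-- **(W3a) EXTERIOR TAIL, geometric form.**  If `|K w| ≤ E·(r+1)⁻⁴·q^{r+1}` on every shell `‖w‖∞ = r+1` with `r ≥ M`
(`0 ≤ q < 1`), then `|Σ_{M<‖w‖∞≤R} K w| ≤ 80E/((M+1)(1−q))` for every `R ≥ M` (`#shell ≤ 80(r+1)³`). [folklore] -/
theorem tail_sum_le_geom {K : Pt → ℝ} {E q : ℝ} {M R : ℕ} (hE : 0 ≤ E) (hq0 : 0 ≤ q) (hq1 : q < 1) (hMR : M ≤ R)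
    (h : ∀ r : ℕ, M ≤ r → ∀ w ∈ annulus 4 r (r + 1), |K w| ≤ E / ((r : ℝ) + 1) ^ 4 * q ^ (r + 1)) :
    |∑ w ∈ annulus 4 M R, K w| ≤ 80 * E / (((M : ℝ) + 1) * (1 - q)) := by
  have h1q : 0 < 1 - q := by linarith
  have hM1 : (0 : ℝ) < (M : ℝ) + 1 := by positivity
  -- shellwise
  have hshell : ∀ r ∈ Finset.Ico M R, shellSum (fun w => |K w|) r ≤ 80 * E / ((M : ℝ) + 1) * q ^ (r + 1) := by
    intro r hr
    have hMr : M ≤ r := (Finset.mem_Ico.mp hr).1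
    have hr1 : (0 : ℝ) < (r : ℝ) + 1 := by positivity
    have hMr' : (M : ℝ) + 1 ≤ (r : ℝ) + 1 := by exact_mod_cast Nat.succ_le_succ hMr
    calc shellSum (fun w => |K w|) r ≤ ∑ _w ∈ annulus 4 r (r + 1), E / ((r : ℝ) + 1) ^ 4 * q ^ (r + 1) :=
          Finset.sum_le_sum fun w hw => h r hMr w hw
      _ = ((annulus 4 r (r + 1)).card : ℝ) * (E / ((r : ℝ) + 1) ^ 4 * q ^ (r + 1)) := by
          rw [Finset.sum_const, nsmul_eq_mul]
      _ ≤ 80 * ((r : ℝ) + 1) ^ 3 * (E / ((r : ℝ) + 1) ^ 4 * q ^ (r + 1)) :=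
          mul_le_mul_of_nonneg_right (card_annulus_succ_four_le r) (by positivity)
      _ = 80 * E / ((r : ℝ) + 1) * q ^ (r + 1) := by field_simp
      _ ≤ 80 * E / ((M : ℝ) + 1) * q ^ (r + 1) := by
          apply mul_le_mul_of_nonneg_right _ (by positivity)
          exact div_le_div_of_nonneg_left (by positivity) hM1 hMr'
  -- geometric sum
  have hgeom : ∑ r ∈ Finset.Ico M R, q ^ (r + 1) ≤ 1 / (1 - q) := by
    have e : ∑ r ∈ Finset.Ico M R, q ^ (r + 1) = q * ∑ r ∈ Finset.Ico M R, q ^ r := by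
      rw [Finset.mul_sum]
      exact Finset.sum_congr rfl fun r _ => by ring
    rw [e]
    have hg := geom_sum_Ico_le_of_lt_one (m := M) (n := R) hq0 hq1
    have hqM : q * q ^ M ≤ 1 := by
      calc q * q ^ M = q ^ (M + 1) := by ring
        _ ≤ 1 := pow_le_one₀ hq0 hq1.le
    calc q * ∑ r ∈ Finset.Ico M R, q ^ r ≤ q * (q ^ M / (1 - q)) := mul_le_mul_of_nonneg_left hg hq0
      _ = q * q ^ M / (1 - q) := by ring
      _ ≤ 1 / (1 - q) := div_le_div_of_nonneg_right hqM h1q.le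
  calc |∑ w ∈ annulus 4 M R, K w| ≤ ∑ w ∈ annulus 4 M R, |K w| := Finset.abs_sum_le_sum_abs _ _
    _ = ∑ r ∈ Finset.Ico M R, shellSum (fun w => |K w|) r := (sum_Ico_shellSum _ hMR).symm
    _ ≤ ∑ r ∈ Finset.Ico M R, 80 * E / ((M : ℝ) + 1) * q ^ (r + 1) := Finset.sum_le_sum hshell
    _ = 80 * E / ((M : ℝ) + 1) * ∑ r ∈ Finset.Ico M R, q ^ (r + 1) := by rw [Finset.mul_sum]
    _ ≤ 80 * E / ((M : ℝ) + 1) * (1 / (1 - q)) := mul_le_mul_of_nonneg_left hgeom (by positivity)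
    _ = 80 * E / (((M : ℝ) + 1) * (1 - q)) := by field_simp

/-- **(W3a) EXTERIOR TAIL, exponential form.**  A shellwise bound `|K w| ≤ E·(r+1)⁻⁴·e^{−(δ/L)(r+1)}` beyond `M`
(`δ > 0`, `L > 0`: decay on scale `L`, i.e. mass `δ/L`) gives `|Σ_{M<‖w‖∞≤R} K w| ≤ 80E(1 + L/δ)/(M+1)`, every `R ≥ M`.
[folklore] -/
theorem tail_sum_le_exp {K : Pt → ℝ} {E δ Lr : ℝ} {M R : ℕ} (hE : 0 ≤ E) (hδ : 0 < δ) (hL : 0 < Lr) (hMR : M ≤ R)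
    (h : ∀ r : ℕ, M ≤ r → ∀ w ∈ annulus 4 r (r + 1),
      |K w| ≤ E / ((r : ℝ) + 1) ^ 4 * Real.exp (-(δ / Lr) * ((r : ℝ) + 1))) :
    |∑ w ∈ annulus 4 M R, K w| ≤ 80 * E * (1 + Lr / δ) / ((M : ℝ) + 1) := by
  set q : ℝ := Real.exp (-(δ / Lr)) with hq
  have hq0 : 0 ≤ q := (Real.exp_pos _).le
  have hx : 0 < δ / Lr := div_pos hδ hL
  have hq1 : q < 1 := Real.exp_lt_one_iff.mpr (by linarith)
  have h' : ∀ r : ℕ, M ≤ r → ∀ w ∈ annulus 4 r (r + 1), |K w| ≤ E / ((r : ℝ) + 1) ^ 4 * q ^ (r + 1) := by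
    intro r hr w hw
    have e : Real.exp (-(δ / Lr) * ((r : ℝ) + 1)) = q ^ (r + 1) := by
      rw [hq, ← Real.exp_nat_mul]
      congr 1
      push_cast
      ring
    rw [← e]
    exact h r hr w hw
  have hM1 : (0 : ℝ) < (M : ℝ) + 1 := by positivity
  have h1q : 0 < 1 - q := by linarith
  -- `1/(1 − e^{−x}) ≤ 1 + 1/x` for `x = δ/Lr > 0` (from `1 + x ≤ eˣ`; the same inequality is the tree's
  -- `Literature.NumberTheory.LFunctions.HuxleyZeroDetection.inv_one_sub_exp_neg_le`, not imported here to keep this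
  -- module's closure inside the Beta tree).
  have hrec : 1 / (1 - q) ≤ 1 + Lr / δ := by
    have h1 : q ≤ 1 / (1 + δ / Lr) := by
      rw [hq, Real.exp_neg, one_div]
      exact inv_anti₀ (by positivity) (by linarith [Real.add_one_le_exp (δ / Lr)])
    have h2 : (δ / Lr) / (1 + δ / Lr) ≤ 1 - q := by
      have : (δ / Lr) / (1 + δ / Lr) = 1 - 1 / (1 + δ / Lr) := by field_simp; ring
      linarith
    have h3 : 0 < (δ / Lr) / (1 + δ / Lr) := by positivity
    calc 1 / (1 - q) ≤ 1 / ((δ / Lr) / (1 + δ / Lr)) := one_div_le_one_div_of_le h3 h2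
      _ = 1 + Lr / δ := by field_simp; ring
  calc |∑ w ∈ annulus 4 M R, K w| ≤ 80 * E / (((M : ℝ) + 1) * (1 - q)) := tail_sum_le_geom hE hq0 hq1 hMR h'
    _ = 80 * E / ((M : ℝ) + 1) * (1 / (1 - q)) := by field_simp
    _ ≤ 80 * E / ((M : ℝ) + 1) * (1 + Lr / δ) := mul_le_mul_of_nonneg_left hrec (by positivity)
    _ = 80 * E * (1 + Lr / δ) / ((M : ℝ) + 1) := by ring

/-- **(W3a) EXTERIOR TAIL under window comparability**: with `1 ≤ M`, `L ≤ c·M` the bound is `80E(1 + c/δ)`, free of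
`L`, `M`, `R`. [folklore] -/
theorem tail_sum_le {K : Pt → ℝ} {E δ cc : ℝ} {L M R : ℕ} (hE : 0 ≤ E) (hδ : 0 < δ) (hL : 1 ≤ L) (hM : 1 ≤ M)
    (hLM : (L : ℝ) ≤ cc * M) (hMR : M ≤ R)
    (h : ∀ r : ℕ, M ≤ r → ∀ w ∈ annulus 4 r (r + 1),
      |K w| ≤ E / ((r : ℝ) + 1) ^ 4 * Real.exp (-(δ / L) * ((r : ℝ) + 1))) :
    |∑ w ∈ annulus 4 M R, K w| ≤ 80 * E * (1 + cc / δ) := by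
  have hM0 : (1 : ℝ) ≤ M := by exact_mod_cast hM
  have hLpos : (0 : ℝ) < L := by exact_mod_cast (by omega : 0 < L)
  have hcc : 0 ≤ cc := by nlinarith
  have h1 := tail_sum_le_exp (Lr := (L : ℝ)) hE hδ hLpos hMR h
  have hM1 : (0 : ℝ) < (M : ℝ) + 1 := by positivity
  have hcδ : 0 ≤ cc / δ := div_nonneg hcc hδ.le
  have h80 : 0 ≤ 80 * E := by positivity
  calc |∑ w ∈ annulus 4 M R, K w| ≤ 80 * E * (1 + (L : ℝ) / δ) / ((M : ℝ) + 1) := h1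
    _ ≤ 80 * E * (1 + cc / δ * M) / ((M : ℝ) + 1) := by
        apply div_le_div_of_nonneg_right _ hM1.le
        apply mul_le_mul_of_nonneg_left _ h80
        have h2 : (L : ℝ) / δ ≤ cc / δ * M := by
          rw [div_mul_eq_mul_div]
          exact div_le_div_of_nonneg_right hLM hδ.le
        linarith
    _ ≤ 80 * E * (1 + cc / δ) := by
        rw [div_le_iff₀ hM1]
        nlinarith

/-- **THE (W3) SPLITTER**: (W3a) a uniform bound `T` on the exterior window sums `Σ_{M(L)<‖w‖∞≤R} K_{L,k}` (all `R ≥ M(L)`) and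
(W3b) the identification `|β⁰(L,k) − Σ_{0<‖w‖∞≤R} K_{L,k}| ≤ U` for SOME `R ≥ M(L)` give (W3) with `A₁′ = T + U`. [folklore] -/
theorem hout_of_split {β0 : ℕ → ℕ → ℝ} {K : ℕ → ℕ → Pt → ℝ} {T U : ℝ} {M : ℕ → ℕ}
    (htail : ∀ L : ℕ, 2 ≤ L → ∀ k : ℕ, ∀ R : ℕ, M L ≤ R → |∑ w ∈ annulus 4 (M L) R, K L k w| ≤ T)
    (hident : ∀ L : ℕ, 2 ≤ L → ∀ k : ℕ, ∃ R : ℕ, M L ≤ R ∧ |β0 L k - ∑ w ∈ annulus 4 0 R, K L k w| ≤ U) :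
    ∀ L : ℕ, 2 ≤ L → ∀ k : ℕ, |β0 L k - ∑ w ∈ annulus 4 0 (M L), K L k w| ≤ T + U := by
  intro L hL k
  obtain ⟨R, hMR, hU⟩ := hident L hL k
  have hT := htail L hL k R hMR
  have e : ∑ w ∈ annulus 4 0 R, K L k w = ∑ w ∈ annulus 4 0 (M L), K L k w + ∑ w ∈ annulus 4 (M L) R, K L k w := by
    rw [← sum_Ico_shellSum _ (Nat.zero_le R), ← sum_Ico_shellSum _ (Nat.zero_le (M L)), ← sum_Ico_shellSum _ hMR,
      Finset.sum_Ico_consecutive _ (Nat.zero_le (M L)) hMR]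
  rw [e] at hU
  calc |β0 L k - ∑ w ∈ annulus 4 0 (M L), K L k w|
      = |(β0 L k - (∑ w ∈ annulus 4 0 (M L), K L k w + ∑ w ∈ annulus 4 (M L) R, K L k w))
          + ∑ w ∈ annulus 4 (M L) R, K L k w| := by ring_nf
    _ ≤ |β0 L k - (∑ w ∈ annulus 4 0 (M L), K L k w + ∑ w ∈ annulus 4 (M L) R, K L k w)|
          + |∑ w ∈ annulus 4 (M L) R, K L k w| := abs_add_le _ _
    _ ≤ U + T := add_le_add hU hT
    _ = T + U := add_comm _ _

/-- (W3a) in (L,k)-indexed form from a shellwise exponential bound beyond the window, under comparability. [folklore] -/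
theorem tail_of_shellBound {K : ℕ → ℕ → Pt → ℝ} {E δ cc : ℝ} {M : ℕ → ℕ} (hE : 0 ≤ E) (hδ : 0 < δ)
    (hM : ∀ L : ℕ, 2 ≤ L → 1 ≤ M L ∧ (L : ℝ) ≤ cc * M L)
    (h : ∀ L : ℕ, 2 ≤ L → ∀ k : ℕ, ∀ r : ℕ, M L ≤ r → ∀ w ∈ annulus 4 r (r + 1),
      |K L k w| ≤ E / ((r : ℝ) + 1) ^ 4 * Real.exp (-(δ / L) * ((r : ℝ) + 1))) :
    ∀ L : ℕ, 2 ≤ L → ∀ k : ℕ, ∀ R : ℕ, M L ≤ R → |∑ w ∈ annulus 4 (M L) R, K L k w| ≤ 80 * E * (1 + cc / δ) := by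
  intro L hL k R hR
  obtain ⟨hM1, hLM⟩ := hM L hL
  exact tail_sum_le hE hδ (by omega) hM1 hLM hR (h L hL k)

end Tail

/-! ### The composite: (W1) + (W2) on the window + (W3a) shellwise decay beyond it + (W3b) identification ⟹ the wall -/

section SplitInterface

variable {ι : Type*} {s : Finset ι} {c : ι → ℝ} {P Q : ι → Leg}

/-- **THE WALL FROM (W1) + (W2) + (W3a) + (W3b)** (RULING (R8)): leg table; in-window comparison with the table's bubble;
scale-`L` exponential decay of the ACTUAL integrand beyond the window (`|K_{L,k}(w)| ≤ E‖w‖∞⁻⁴e^{−δ‖w‖∞/L}`, shellwise);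
identification of `β⁰(L,k)` with a full lattice sum of `K_{L,k}` up to `U` ⟹ the wall with `A₁ = (80E(1 + c/δ) + U) + 80D`.
[folklore] -/
theorem windowDecomposition_of_splitInterface (hdeg : ∀ i ∈ s, (P i).a + (Q i).a = 6) {μ ν : Fin 4} {κ : ℝ}
    (hval : ∀ x : E4, x ≠ 0 → x μ * x ν * contBubble s c P Q x = leadingIntegrand κ μ ν x)
    {β0 : ℕ → ℕ → ℝ} {K : ℕ → ℕ → Pt → ℝ} {D E δ U cc : ℝ} {M : ℕ → ℕ} (hD : 0 ≤ D) (hE : 0 ≤ E) (hδ : 0 < δ)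
    (hc : 1 ≤ cc) (hM : ∀ L : ℕ, 2 ≤ L → 1 ≤ M L ∧ (L : ℝ) ≤ cc * M L) (hML : ∀ L : ℕ, 2 ≤ L → M L ≤ L)
    (hin : ∀ L : ℕ, 2 ≤ L → ∀ k : ℕ, ∀ w ∈ annulus 4 0 (M L),
      |K L k w - toReal w μ * toReal w ν * lattBubble s c P Q L k w| ≤ D / ((supNorm w : ℝ) ^ 2 * (L : ℝ) ^ 2))
    (htail : ∀ L : ℕ, 2 ≤ L → ∀ k : ℕ, ∀ r : ℕ, M L ≤ r → ∀ w ∈ annulus 4 r (r + 1),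
      |K L k w| ≤ E / ((r : ℝ) + 1) ^ 4 * Real.exp (-(δ / L) * ((r : ℝ) + 1)))
    (hident : ∀ L : ℕ, 2 ≤ L → ∀ k : ℕ, ∃ R : ℕ, M L ≤ R ∧ |β0 L k - ∑ w ∈ annulus 4 0 R, K L k w| ≤ U) :
    WindowDecomposition β0 (fun w => leadingIntegrand κ μ ν (toReal w)) (|κ| * 24 + |κ| * 110592) (bubbleConst s c P Q)
      ((80 * E * (1 + cc / δ) + U) + 80 * D) cc M :=
  windowDecomposition_of_interface' hdeg hval hD hc hM hML hin
    (hout_of_split (tail_of_shellBound hE hδ hM htail) hident)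

end SplitInterface

/-! ## 8. (v1.3) (W3a) at leg level, and the all-leg-level composite -/

section LegTail

open Literature.MathematicalPhysics.QuantumFieldTheory.Balaban1983to89.Beta.DyadicShell (supNorm_eq_of_mem_sphere)

variable {ι : Type*} {s : Finset ι} {c : ι → ℝ} {P Q : ι → Leg}

/-- **(W3a) AT LEG LEVEL, one shell point.**  On the shell `‖w‖∞ = r+1`, leg bounds `|F_i| ≤ R_i(r+1)^{−a_{P_i}}·ε` and
`|G_i| ≤ S_i(r+1)^{−a_{Q_i}}` with total degrees `6` (`ε ≥ 0` any common factor, e.g. `e^{−(δ/L)(r+1)}`) give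
`|w_μw_ν·Σ_i c_iF_iG_i| ≤ (Σ_i |c_i|R_iS_i)·(r+1)⁻⁴·ε`. [folklore] -/
theorem shellBound_of_legDecay (hdeg : ∀ i ∈ s, (P i).a + (Q i).a = 6) (μ ν : Fin 4) {r : ℕ} {w : Pt}
    (hw : w ∈ annulus 4 r (r + 1)) {F G R S : ι → ℝ} {ε : ℝ} (hε : 0 ≤ ε) (hR : ∀ i ∈ s, 0 ≤ R i)
    (hF : ∀ i ∈ s, |F i| ≤ R i / ((r : ℝ) + 1) ^ (P i).a * ε)
    (hG : ∀ i ∈ s, |G i| ≤ S i / ((r : ℝ) + 1) ^ (Q i).a) :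
    |toReal w μ * toReal w ν * ∑ i ∈ s, c i * (F i * G i)| ≤
      (∑ i ∈ s, |c i| * (R i * S i)) / ((r : ℝ) + 1) ^ 4 * ε := by
  have hr1 : (0 : ℝ) < (r : ℝ) + 1 := by positivity
  have hsup : (supNorm w : ℝ) = (r : ℝ) + 1 := by rw [supNorm_eq_of_mem_sphere hw]; push_cast; ring
  have hmom : |toReal w μ * toReal w ν| ≤ ((r : ℝ) + 1) ^ 2 := by rw [← hsup]; exact abs_moment_le μ ν w
  have hsum : |∑ i ∈ s, c i * (F i * G i)| ≤ (∑ i ∈ s, |c i| * (R i * S i)) / ((r : ℝ) + 1) ^ 6 * ε := by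
    rw [Finset.sum_div, Finset.sum_mul]
    refine (Finset.abs_sum_le_sum_abs _ _).trans (Finset.sum_le_sum fun i hi => ?_)
    have hRi := hR i hi
    rw [abs_mul, abs_mul]
    calc |c i| * (|F i| * |G i|) ≤ |c i| * (R i / ((r : ℝ) + 1) ^ (P i).a * ε * (S i / ((r : ℝ) + 1) ^ (Q i).a)) := by
          refine mul_le_mul_of_nonneg_left ?_ (abs_nonneg _)
          exact mul_le_mul (hF i hi) (hG i hi) (abs_nonneg _) (by positivity)
      _ = |c i| * (R i * S i) / ((r : ℝ) + 1) ^ ((P i).a + (Q i).a) * ε := by rw [pow_add]; field_simp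
      _ = |c i| * (R i * S i) / ((r : ℝ) + 1) ^ 6 * ε := by rw [hdeg i hi]
  have hEnn : 0 ≤ (∑ i ∈ s, |c i| * (R i * S i)) / ((r : ℝ) + 1) ^ 6 * ε := le_trans (abs_nonneg _) hsum
  rw [abs_mul]
  calc |toReal w μ * toReal w ν| * |∑ i ∈ s, c i * (F i * G i)|
      ≤ ((r : ℝ) + 1) ^ 2 * ((∑ i ∈ s, |c i| * (R i * S i)) / ((r : ℝ) + 1) ^ 6 * ε) :=
        mul_le_mul hmom hsum (abs_nonneg _) (by positivity)
    _ = (∑ i ∈ s, |c i| * (R i * S i)) / ((r : ℝ) + 1) ^ 4 * ε := by field_simp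

/-- **THE ALL-LEG-LEVEL COMPOSITE (W1) + (W2′) + (W3a-leg) + (W3b) ⟹ THE WALL.**  Table legs `P_i, Q_i` (total degree 6,
continuum moment `κ·T`); actual legs `F′_i, G′_i : ℕ → ℕ → ℤ⁴ → ℝ` with, ON THE WINDOW, the scale-`L` perturbation bounds
(W2′) and, BEYOND THE WINDOW, shellwise decay `|F′_i| ≤ R′_i‖w‖∞^{−a_{P_i}}e^{−δ‖w‖∞/L}`, `|G′_i| ≤ S′_i‖w‖∞^{−a_{Q_i}}`;
identification (W3b) of `β⁰(L,k)` with a full lattice sum of `K = w_μw_ν·Σ c_iF′_iG′_i` up to `U` ⟹ the wall with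
`A₁ = (80E(1 + c/δ) + U) + 80D`, `E = Σ|c_i|R′_iS′_i`, `D = Σ|c_i|((A_{P_i}+B_{P_i})S_i + R_i(A_{Q_i}+B_{Q_i}) + R_iS_i)`.
What stays above leg level: that Bałaban's β⁰ and reorganised integrand furnish such `F′, G′` and (W3b). [folklore] -/
theorem windowDecomposition_of_legSplitInterface (hdeg : ∀ i ∈ s, (P i).a + (Q i).a = 6) {μ ν : Fin 4} {κ : ℝ}
    (hval : ∀ x : E4, x ≠ 0 → x μ * x ν * contBubble s c P Q x = leadingIntegrand κ μ ν x)
    {β0 : ℕ → ℕ → ℝ} {F' G' : ι → ℕ → ℕ → Pt → ℝ} {R S R' S' : ι → ℝ} {δ U cc : ℝ} {M : ℕ → ℕ}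
    (hR : ∀ i ∈ s, 0 ≤ R i) (hS : ∀ i ∈ s, 0 ≤ S i) (hR' : ∀ i ∈ s, 0 ≤ R' i) (hS' : ∀ i ∈ s, 0 ≤ S' i) (hδ : 0 < δ)
    (hc : 1 ≤ cc) (hM : ∀ L : ℕ, 2 ≤ L → 1 ≤ M L ∧ (L : ℝ) ≤ cc * M L) (hML : ∀ L : ℕ, 2 ≤ L → M L ≤ L)
    (hF : ∀ L : ℕ, 2 ≤ L → ∀ k : ℕ, ∀ w ∈ annulus 4 0 (M L), ∀ i ∈ s,
      |F' i L k w - (P i).f L k w| ≤ R i / ((supNorm w : ℝ) ^ ((P i).a - 2) * (L : ℝ) ^ 2))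
    (hG : ∀ L : ℕ, 2 ≤ L → ∀ k : ℕ, ∀ w ∈ annulus 4 0 (M L), ∀ i ∈ s,
      |G' i L k w - (Q i).f L k w| ≤ S i / ((supNorm w : ℝ) ^ ((Q i).a - 2) * (L : ℝ) ^ 2))
    (hFtail : ∀ L : ℕ, 2 ≤ L → ∀ k : ℕ, ∀ r : ℕ, M L ≤ r → ∀ w ∈ annulus 4 r (r + 1), ∀ i ∈ s,
      |F' i L k w| ≤ R' i / ((r : ℝ) + 1) ^ (P i).a * Real.exp (-(δ / L) * ((r : ℝ) + 1)))
    (hGtail : ∀ L : ℕ, 2 ≤ L → ∀ k : ℕ, ∀ r : ℕ, M L ≤ r → ∀ w ∈ annulus 4 r (r + 1), ∀ i ∈ s,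
      |G' i L k w| ≤ S' i / ((r : ℝ) + 1) ^ (Q i).a)
    (hident : ∀ L : ℕ, 2 ≤ L → ∀ k : ℕ, ∃ R₀ : ℕ, M L ≤ R₀ ∧
      |β0 L k - ∑ w ∈ annulus 4 0 R₀, toReal w μ * toReal w ν * ∑ i ∈ s, c i * (F' i L k w * G' i L k w)| ≤ U) :
    WindowDecomposition β0 (fun w => leadingIntegrand κ μ ν (toReal w)) (|κ| * 24 + |κ| * 110592) (bubbleConst s c P Q)
      ((80 * (∑ i ∈ s, |c i| * (R' i * S' i)) * (1 + cc / δ) + U) +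
        80 * ∑ i ∈ s, |c i| * ((((P i).A + (P i).B) * S i + R i * ((Q i).A + (Q i).B) + R i * S i))) cc M := by
  have hE : 0 ≤ ∑ i ∈ s, |c i| * (R' i * S' i) :=
    Finset.sum_nonneg fun i hi => mul_nonneg (abs_nonneg _) (mul_nonneg (hR' i hi) (hS' i hi))
  have htail : ∀ L : ℕ, 2 ≤ L → ∀ k : ℕ, ∀ r : ℕ, M L ≤ r → ∀ w ∈ annulus 4 r (r + 1),
      |toReal w μ * toReal w ν * ∑ i ∈ s, c i * (F' i L k w * G' i L k w)| ≤
        (∑ i ∈ s, |c i| * (R' i * S' i)) / ((r : ℝ) + 1) ^ 4 * Real.exp (-(δ / L) * ((r : ℝ) + 1)) :=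
    fun L hL k r hr w hw =>
      shellBound_of_legDecay hdeg μ ν hw (Real.exp_pos _).le hR' (fun i hi => hFtail L hL k r hr w hw i hi)
        (fun i hi => hGtail L hL k r hr w hw i hi)
  exact windowDecomposition_of_legInterface hdeg hval hR hS hc hM hML hF hG
    (hout_of_split (tail_of_shellBound hE hδ hM htail) hident)

end LegTail

/-! ## 9. (v1.4) Scale-form adapters: `R/L^a` on the window ⟹ (W2′) shape; `C·L^{−a}e^{−(δ₀/L)(r+1)}` beyond ⟹ (W3a-leg) shape -/

section ScaleAdapters

/-- **WINDOW ADAPTER.**  A scale-`L` bound `|F′ − f| ≤ R/L^a` at a window point (`1 ≤ ‖w‖∞ ≤ L`, `a ≥ 2`) implies the (W2′)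
shape `|F′ − f| ≤ R/(‖w‖∞^{a−2}·L²)` — since `‖w‖∞^{a−2}L² ≤ L^a`.  (For an5's Woodbury fibre bounds `D₀L⁻²` (a = 2),
`D₁L⁻³` (a = 3), `D₂L⁻⁴` (a = 4).) [folklore] -/
theorem windowBound_of_scaleBound {x R : ℝ} {a L : ℕ} {w : Pt} (hR : 0 ≤ R) (ha : 2 ≤ a) (hw : w ≠ 0)
    (hwL : (supNorm w : ℝ) ≤ L) (h : |x| ≤ R / (L : ℝ) ^ a) :
    |x| ≤ R / ((supNorm w : ℝ) ^ (a - 2) * (L : ℝ) ^ 2) := by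
  have hs : (1 : ℝ) ≤ supNorm w := Leg.one_le_supNorm hw
  have hL : (1 : ℝ) ≤ L := hs.trans hwL
  have hden : (supNorm w : ℝ) ^ (a - 2) * (L : ℝ) ^ 2 ≤ (L : ℝ) ^ a := by
    calc (supNorm w : ℝ) ^ (a - 2) * (L : ℝ) ^ 2 ≤ (L : ℝ) ^ (a - 2) * (L : ℝ) ^ 2 :=
          mul_le_mul_of_nonneg_right (pow_le_pow_left₀ (by linarith) hwL _) (by positivity)
      _ = (L : ℝ) ^ a := by rw [← pow_add, Nat.sub_add_cancel ha]
  exact h.trans (div_le_div_of_nonneg_left hR (by positivity) hden)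

/-- **EXTERIOR ADAPTER.**  A scale-`L` exponential bound `|F′| ≤ C·L^{−a}·e^{−(δ₀/L)(r+1)}` on the shell `‖w‖∞ = r+1`
(`L > 0`, `δ₀ > 0`) implies the (W3a-leg) shape `|F′| ≤ R′·(r+1)^{−a}·e^{−(δ₀/(2L))(r+1)}` with `R′ = C·a!·(2/δ₀)^a`, free
of `L` and `r`: half the rate pays for the power via `x^a ≤ a!eˣ` at `x = (δ₀/(2L))(r+1)`.  No window comparability is
needed. [folklore] -/
theorem shellBound_of_scaleExp {x C δ₀ Lr : ℝ} {a r : ℕ} (hC : 0 ≤ C) (hδ : 0 < δ₀) (hL : 0 < Lr)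
    (h : |x| ≤ C / Lr ^ a * Real.exp (-(δ₀ / Lr) * ((r : ℝ) + 1))) :
    |x| ≤ C * (a.factorial : ℝ) * (2 / δ₀) ^ a / ((r : ℝ) + 1) ^ a * Real.exp (-(δ₀ / (2 * Lr)) * ((r : ℝ) + 1)) := by
  set t : ℝ := (r : ℝ) + 1 with ht
  have ht0 : 0 < t := by positivity
  set κ : ℝ := δ₀ / (2 * Lr) with hκ
  have hκ0 : 0 < κ := by positivity
  -- `t^a ≤ a! κ^{-a} e^{κ t}` from `x^a ≤ a!·eˣ` (`Real.pow_div_factorial_le_exp`; the packaged inequality is the tree's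
  -- `Literature.NumberTheory.Sieve.Iwaniec1980b.pow_le_factorial_mul_exp`, not imported to keep this module's closure in Beta/)
  have hpow : t ^ a ≤ (a.factorial : ℝ) / κ ^ a * Real.exp (κ * t) := by
    have h1 : (κ * t) ^ a ≤ (a.factorial : ℝ) * Real.exp (κ * t) := by
      have h0 := Real.pow_div_factorial_le_exp (κ * t) (mul_nonneg hκ0.le ht0.le) a
      have hf : (0 : ℝ) < a.factorial := by exact_mod_cast Nat.factorial_pos a
      rw [div_le_iff₀ hf] at h0
      linarith
    rw [mul_pow] at h1
    rw [div_mul_eq_mul_div, le_div_iff₀ (by positivity)]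
    calc t ^ a * κ ^ a = κ ^ a * t ^ a := by ring
      _ ≤ (a.factorial : ℝ) * Real.exp (κ * t) := h1
  -- rewrite the target constant
  have hexp : Real.exp (-(δ₀ / Lr) * t) = Real.exp (-κ * t) * Real.exp (-κ * t) := by
    rw [← Real.exp_add]; congr 1; rw [hκ]; field_simp; ring
  have hkey : C / Lr ^ a * Real.exp (-(δ₀ / Lr) * t) ≤
      C * (a.factorial : ℝ) * (2 / δ₀) ^ a / t ^ a * Real.exp (-κ * t) := by
    rw [hexp, ← mul_assoc]
    apply mul_le_mul_of_nonneg_right _ (Real.exp_pos _).le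
    -- `C/Lr^a · e^{−κt} ≤ C·a!·(2/δ₀)^a / t^a`
    rw [div_mul_eq_mul_div, div_le_div_iff₀ (by positivity) (by positivity)]
    have h2 : t ^ a * Real.exp (-κ * t) ≤ (a.factorial : ℝ) / κ ^ a := by
      have := mul_le_mul_of_nonneg_right hpow (Real.exp_pos (-κ * t)).le
      rwa [mul_assoc, ← Real.exp_add, show κ * t + -κ * t = 0 by ring, Real.exp_zero, mul_one] at this
    have h3 : (a.factorial : ℝ) / κ ^ a = (a.factorial : ℝ) * (2 / δ₀) ^ a * Lr ^ a := by
      have hk : κ⁻¹ = 2 / δ₀ * Lr := by rw [hκ]; field_simp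
      rw [div_eq_mul_inv, ← inv_pow, hk, mul_pow]; ring
    calc C * Real.exp (-κ * t) * t ^ a = C * (t ^ a * Real.exp (-κ * t)) := by ring
      _ ≤ C * ((a.factorial : ℝ) / κ ^ a) := mul_le_mul_of_nonneg_left h2 hC
      _ = C * (a.factorial : ℝ) * (2 / δ₀) ^ a * Lr ^ a := by rw [h3]; ring
  exact h.trans hkey

end ScaleAdapters

end

end Literature.MathematicalPhysics.QuantumFieldTheory.Balaban1983to89.Beta.WindowInterface
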